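import Summits.QuantumFields.BalabanUV.Beta.D1BFx.GhostLegLattice

/-!
# `BalabanUV.Beta.D1BFx.GhostLegProfile` — road «BF-x» for binder row D1, slot (K), (II)-rows (C1)(C2) «TB4-W CO-FRAME FIRST JET ∕ TABLE,
# m-UNIFORM MASS», FILE β2 «GGH-PROFILE»: **THE SHORT-DISTANCE PROFILE OF THE SCALAR GHOST LEG `Ggh (L^k) a` AND OF ITS LATTICE GRADIENTS
# (`C·n⁻²·(max 1 |x−y|_∞)^{−2∕−3}·e^{−δ|x−y|_∞∕n}`), AND ITS n-FREE θ-WEIGHTED ℓ¹ ROW∕COLUMN MASSES `g₀` (value) ∕ `g₁∕n` (gradients)** — the ONE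
# analytic letter of the (C1)(C2) count (this seat's W-1 l.43312 (F2)(F3); OWNER RULING ρ-g19-1∕-2∕-3 l.43347∕l.43441)

HONEST DEPENDENCY (cell records, verbatim): «continuum YM on T⁴ ⇐ BetaPertH ∧ nine spine estimates (0/9 proved); BetaPertH ⇐ (D1) ∧ (D4) ∧
CAP+tail; G-an2-4 gates asym, D1 and NE2/3/4.»  HONEST FRAMING (cell contract, verbatim): «discharging `BetaPertH` makes Bałaban's UV stability
UNCONDITIONAL — a real constructive-QFT result; it is NOT the continuum limit and NOT the Clay problem.»  THIS MODULE DISCHARGES NOTHING of the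
wall: the analytic input is lit-balaban's KERNEL-CHECKED `B3GkZeroLatticePointwise.abs_GkLat_profile ∕ abs_GkLatDiff_profile ∕ abs_GkLatDiff'_profile`
([Balaban1983Higgs3] p. 437 «|G^ξ_{j″}(0; y, y′)| ≦ O(1)e^{−δ₀|y−y′|}∕|y − y′| and the corresponding inequalities for derivatives», proved there for every
`d + 1 ≥ 3` from [Balaban1983RegularityDecay]'s zero-field box lineage), read through FILE β1's bridge `GhostLegLattice.Ggh_eq_GkLat` and summed over `ℤ⁴`
with β1's shell toolkit — [folklore] bookkeeping BY NAME.  No definition, no `def … : Prop`, nothing cited as a hypothesis, 0 sorry.  0 root-level binders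
of row D1 discharged (hW ∕ hR-sockets ∕ hSX-socket ∕ D1Tel ∕ D1Rep = 0); (K) NOT closed; (C1)(C2) NOT closed by this file (it is their leg letter); NOT D1,
NOT `BetaPertH`, NOT continuum, NOT Clay.

ABSOLUTE RULE (cell charter, verbatim): «No internally-minted statement may enter as a cited fact. Every hypothesis is either kernel-proved in
this package or a verbatim quotation of a PUBLISHED theorem with page reference. The manuscript(s) under audit are NOT citable for their own
disputed steps — they are the thing under adjudication; programme-internal (2001/route/tribunal) claims are never citable.»

WHY.  The sixteen P4b chain words of the co-frame table (C2) and the combined projection-jet of (C1) count `n⁰` in the ℓ¹-MASS currency (row∕column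
masses compose multiplicatively, no `Zl` per composition) GIVEN n-free masses of the legs; every leg of the road (`lapU∘Ggh`, `gq`, `Pgt`, `Rgt`,
`Cgh = n⁴·Ggh∘Rgt∘Ggh`, `lapU∘Cgh`) is a polynomial in `Ggh`, so ONE letter suffices: the θ-weighted row∕column mass of `Ggh` (`g₀`, from the `r⁻²`
profile) and of its lattice gradients (`g₁∕n`, from the `r⁻³` profile — the `1∕n` gain (C1)'s outer `dSw` differences need).  The road's own letter
`GhostLeg.abs_Ggh_le` (`2∕min 2 a`, sup) gives `n⁴` for both through `Zl`.

CONTENT (`L ≥ 2`, `a > 0`; scales `n = L^k`, `k ≥ 1`; `|·|_∞ = B3CxiUniformBound.supNorm` (ℕ-valued), `|·|₁ = B12Sec2to5.l1`).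
* §1 [folklore] `cast_supNorm_eq4` (the tree's two sup norms agree on `ℤ⁴`), `supNorm_le_l1_le` (`|u|_∞ ≤ |u|₁ ≤ 4|u|_∞`).
* §2 [folklore] **`exists_Ggh_profile`**: `∃ δ C > 0, ∀ k ≥ 1, n = L^k, ∀ x y μ: |Ggh n a x y| ≤ C·n⁻²·(max 1 s)⁻²·e^{−δs∕n}`,
  `|Ggh n a (x+e_μ) y − Ggh n a x y|, |Ggh n a x (y+e_μ) − Ggh n a x y| ≤ C·n⁻²·(max 1 s)⁻³·e^{−δs∕n}` (`s = |x−y|_∞`).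
* §3 [folklore] `tsum_weighted_le_of_profile` (model-free: profile `p ∈ {2,3}` ⟹ θ-weighted row∕column sums `≤ C·n⁻²·(1 + 2560∕(δ∕2n)^{4−p})` for
  `θ ≤ δ∕(8n)`), **`exists_Ggh_masses`**: `∃ δ > 0, g₀ g₁ ≥ 0, ∀ k ≥ 1, n = L^k, ∀ θ ≤ δ∕(8n), ∀ x μ:` `Σ'_y |Ggh n a x y|·e^{θ|x−y|₁} ≤ g₀`,
  `Σ'_y |Ggh n a (x+e_μ) y − Ggh n a x y|·e^{θ|x−y|₁} ≤ g₁∕n`, `Σ'_y |Ggh n a (y+e_μ) x − Ggh n a y x|·e^{θ|y−x|₁} ≤ g₁∕n`,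
  `Σ'_y |Ggh n a x (y+e_μ) − Ggh n a x y|·e^{θ|x−y|₁} ≤ g₁∕n` (all summable; columns of the value by `GhostLeg.Ggh_symm`).
NOT HERE: the leg masses `lapU∘Ggh ∕ gq ∕ Pgt ∕ Rgt ∕ Cgh ∕ lapU∘Cgh` (FILE γ «LEG-MASS»), the word masses (FILE δ), any (1.22) row.
Unit `b2b-balaban-gan24-formalise-leaf-05` (gen 54), G-an2-4 swarm leaf prover 05, road «BF-x» (C1)(C2) count owner; INTENT «GGH-PROFILE» (journal).
-/


noncomputable section

namespace Summit.QuantumFields.BalabanUV.Beta.D1BFx.GhostLegProfile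

open scoped BigOperators
open Finset
open Literature.MathematicalPhysics.QuantumFieldTheory.Balaban1983to89
open Literature.MathematicalPhysics.QuantumFieldTheory.Balaban1983to89.Beta
open ExpKernelCalculus (Site MKer summable_exp_shift)
open B12Sec2to5 (l1 l1_nonneg)
open B6QGQLower276 (e)
open B3Sect3VectorSelfEnergy (ZSite)
open B3CxiUniformBound (supNorm le_supNorm)
open Summit.QuantumFields.BalabanUV.Beta.D1BFx.GhostLeg (Ggh Ggh_apply Ggh_symm)
open Summit.QuantumFields.BalabanUV.Beta.D1BFx.GhostLegLattice (Ggh_eq_GkLat exists_aSeq_eq cast_L_pred sum_profile4_le)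

/-! ## §1 Norms; §2 the short-distance PROFILES of `Ggh (L^k) a` and of its lattice differences (pointwise, n = L^k, k ≥ 1) -/

section Profile

open B3GkZeroLattice (GkLat)

/-- [folklore] The ℕ-valued sup norm of `B3CxiUniformBound` and the ℝ-valued sup norm of `B4ContourShift` agree on `ℤ⁴`
(the `ℤ³` twin is `B3Eq316ResolventZeroLattice.cast_supNorm_eq`). -/
theorem cast_supNorm_eq4 (u : Site 4) : ((supNorm (d := 4) u : ℕ) : ℝ) = B4ContourShift.supNorm (d := 3) u := by
  apply le_antisymm
  · obtain ⟨μ, -, hμ⟩ := Finset.exists_mem_eq_sup Finset.univ Finset.univ_nonempty (fun μ : Fin 4 => (u μ).natAbs)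
    have h1 : supNorm (d := 4) u = (u μ).natAbs := hμ
    have h2 := B4ContourShift.abs_le_supNorm (d := 3) u μ
    rw [h1, Nat.cast_natAbs]
    exact h2
  · obtain ⟨i, hi⟩ := B4ContourShift.exists_supNorm_eq (d := 3) u
    have h := le_supNorm (d := 4) u i
    have h' : (((u i).natAbs : ℕ) : ℝ) ≤ (supNorm (d := 4) u : ℝ) := by exact_mod_cast h
    rw [hi, ← Nat.cast_natAbs]
    exact h'

/-- [folklore] `|u|_∞ ≤ |u|₁ ≤ 4·|u|_∞` on `ℤ⁴` (the road's `l1` against the sup norm). -/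
theorem supNorm_le_l1_le (u : Site 4) :
    ((supNorm (d := 4) u : ℕ) : ℝ) ≤ l1 u ∧ l1 u ≤ 4 * ((supNorm (d := 4) u : ℕ) : ℝ) := by
  have hterm : ∀ μ : Fin 4, |((u μ : ℤ) : ℝ)| = (((u μ).natAbs : ℕ) : ℝ) := fun μ => by
    rw [Nat.cast_natAbs, Int.cast_abs]
  constructor
  · obtain ⟨μ, -, hμ⟩ := Finset.exists_mem_eq_sup Finset.univ Finset.univ_nonempty (fun μ : Fin 4 => (u μ).natAbs)
    have h1 : supNorm (d := 4) u = (u μ).natAbs := hμ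
    rw [h1, ← hterm μ]
    exact Finset.single_le_sum (f := fun ν => |((u ν : ℤ) : ℝ)|) (fun ν _ => abs_nonneg _) (Finset.mem_univ μ)
  · have hle : ∀ μ : Fin 4, |((u μ : ℤ) : ℝ)| ≤ ((supNorm (d := 4) u : ℕ) : ℝ) := fun μ => by
      rw [hterm μ]; exact_mod_cast le_supNorm (d := 4) u μ
    calc l1 u = ∑ μ : Fin 4, |((u μ : ℤ) : ℝ)| := rfl
      _ ≤ ∑ _μ : Fin 4, ((supNorm (d := 4) u : ℕ) : ℝ) := Finset.sum_le_sum fun μ _ => hle μ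
      _ = 4 * _ := by simp

variable {L : ℕ} (hL : 2 ≤ L) {a : ℝ} (ha : 0 < a)
include hL ha

/-- [folklore] **«GGH-PROFILE» — THE SHORT-DISTANCE PROFILE OF THE SCALAR GHOST LEG AND OF ITS LATTICE GRADIENTS, UNIFORMLY ON THE SCALES
`n = L^k`**: there are `δ > 0`, `C > 0` (depending on `L ≥ 2` and `a > 0` only) such that for every `k ≥ 1`, `n = L^k`, all `x y ∈ ℤ⁴`, `μ`
(`s := |x − y|_∞`):  `|Ggh n a x y| ≤ C·n⁻²·(max 1 s)⁻²·e^{−δ s∕n}`,  `|Ggh n a (x+e_μ) y − Ggh n a x y| ≤ C·n⁻²·(max 1 s)⁻³·e^{−δ s∕n}` and the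
same for the column difference — lit-balaban's `B3GkZeroLatticePointwise.abs_GkLat_profile ∕ abs_GkLatDiff_profile ∕ abs_GkLatDiff'_profile`
([Balaban1983Higgs3] p. 437 for the printed `G_k(0)`, proved there for every `d + 1 ≥ 3`) read through the bridge `Ggh_eq_GkLat`.  The road's
`GhostLeg.abs_Ggh_le` (`≤ 2∕min 2 a`) is the `s = 0`, power-free shadow of the first clause. -/
theorem exists_Ggh_profile : ∃ δ C : ℝ, 0 < δ ∧ 0 < C ∧ ∀ (k : ℕ), 1 ≤ k → ∀ (n : ℕ) [NeZero n], n = L ^ k →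
    ∀ (x y : Site 4) (u v : Unit),
      |Ggh n a x y u v| ≤ C * ((n : ℝ) ^ 2)⁻¹ * ((max 1 ((supNorm (d := 4) (x - y) : ℕ) : ℝ)) ^ 2)⁻¹ *
          Real.exp (-(δ * (supNorm (d := 4) (x - y) : ℕ) / n)) ∧
      (∀ μ : Fin 4, |Ggh n a (x + e μ) y u v - Ggh n a x y u v|
          ≤ C * ((n : ℝ) ^ 2)⁻¹ * ((max 1 ((supNorm (d := 4) (x - y) : ℕ) : ℝ)) ^ 3)⁻¹ *
            Real.exp (-(δ * (supNorm (d := 4) (x - y) : ℕ) / n))) ∧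
      (∀ μ : Fin 4, |Ggh n a x (y + e μ) u v - Ggh n a x y u v|
          ≤ C * ((n : ℝ) ^ 2)⁻¹ * ((max 1 ((supNorm (d := 4) (x - y) : ℕ) : ℝ)) ^ 3)⁻¹ *
            Real.exp (-(δ * (supNorm (d := 4) (x - y) : ℕ) / n))) := by
  set aplus : ℝ := a / (1 - ((L : ℝ) ^ 2)⁻¹) with haplus
  obtain ⟨δ₀, C₀, hδ₀, hC₀, h₀⟩ := B3GkZeroLatticePointwise.abs_GkLat_profile 3 (L - 1) (by norm_num) (by omega) a aplus 0 ha
  obtain ⟨δ₁, C₁, hδ₁, hC₁, h₁⟩ := B3GkZeroLatticePointwise.abs_GkLatDiff_profile 3 (L - 1) (by norm_num) (by omega) a aplus 0 ha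
  obtain ⟨δ₂, C₂, hδ₂, hC₂, h₂⟩ := B3GkZeroLatticePointwise.abs_GkLatDiff'_profile 3 (L - 1) (by norm_num) (by omega) a aplus 0 ha
  set δ : ℝ := min δ₀ (min δ₁ δ₂) with hδ
  set C : ℝ := max C₀ (max C₁ C₂) with hC
  have hδle₀ : δ ≤ δ₀ := min_le_left _ _
  have hδle₁ : δ ≤ δ₁ := (min_le_right _ _).trans (min_le_left _ _)
  have hδle₂ : δ ≤ δ₂ := (min_le_right _ _).trans (min_le_right _ _)
  have hCge₀ : C₀ ≤ C := le_max_left _ _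
  have hCge₁ : C₁ ≤ C := (le_max_left _ _).trans (le_max_right _ _)
  have hCge₂ : C₂ ≤ C := (le_max_right _ _).trans (le_max_right _ _)
  have hδpos : 0 < δ := lt_min hδ₀ (lt_min hδ₁ hδ₂)
  have hCpos : 0 < C := lt_of_lt_of_le hC₀ hCge₀
  refine ⟨δ, C, hδpos, hCpos, fun k hk n _ hn x y u v => ?_⟩
  obtain ⟨a', haS, hw⟩ := exists_aSeq_eq hL ha.le hk
  have hLr : (((L - 1 : ℕ) : ℝ)) + 1 = (L : ℝ) := (cast_L_pred hL).1
  have hnr : (n : ℝ) = (L : ℝ) ^ k := by rw [hn]; push_cast; ring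
  have hn0 : (0 : ℝ) < (n : ℝ) := by rw [hnr]; positivity
  -- the three lit-balaban bounds at `a′`, rewritten in the road's variables
  have hG : ∀ z w : Site 4, Ggh n a z w u v = GkLat (d := 3) (L - 1) k a' 0 z w := fun z w => Ggh_eq_GkLat hL hk ha haS hw n hn z w u v
  set s : ℝ := ((supNorm (d := 4) (x - y) : ℕ) : ℝ) with hs
  have hsB : B4ContourShift.supNorm (d := 3) (x - y) = s := (cast_supNorm_eq4 (x - y)).symm
  have hs0 : 0 ≤ s := by rw [hs]; exact Nat.cast_nonneg _
  have hm1 : 1 ≤ max 1 s := le_max_left _ _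
  have hm0 : 0 < max 1 s := lt_of_lt_of_le one_pos hm1
  -- common algebra: `(max 1 s ∕ n)⁻¹^p = n^p ∕ (max 1 s)^p`
  have hfac : ∀ p : ℕ, (max 1 s / (n : ℝ))⁻¹ ^ p = (n : ℝ) ^ p * ((max 1 s) ^ p)⁻¹ := fun p => by
    rw [inv_div, div_pow, div_eq_mul_inv]
  have hexpmono : ∀ {δ' : ℝ}, δ ≤ δ' → Real.exp (-(δ' * (s / (n : ℝ)))) ≤ Real.exp (-(δ * s / n)) := fun hle => by
    rw [Real.exp_le_exp]
    have : 0 ≤ s / (n : ℝ) := by positivity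
    have : δ * s / n = δ * (s / n) := by ring
    rw [this]; nlinarith
  refine ⟨?_, fun μ => ?_, fun μ => ?_⟩
  · have hb := h₀ k hk a' 0 hw.1 hw.2 le_rfl le_rfl x y
    rw [hLr, ← hnr, hsB, ← hG, hfac] at hb
    -- hb : n^4 * |G| ≤ C₀ * (n^2 * (max 1 s)^2⁻¹) * exp(−δ₀ (s/n))
    have hn4 : (0 : ℝ) < (n : ℝ) ^ (3 + 1) := by positivity
    have key : |Ggh n a x y u v| ≤ C₀ * ((n : ℝ) ^ 2 * ((max 1 s) ^ (3 - 1))⁻¹) * Real.exp (-(δ₀ * (s / (n : ℝ)))) / (n : ℝ) ^ (3 + 1) := by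
      rw [le_div_iff₀ hn4, mul_comm]; exact hb
    refine key.trans ?_
    rw [show (3 - 1 : ℕ) = 2 from rfl, div_le_iff₀ hn4]
    have e1 : C * ((n : ℝ) ^ 2)⁻¹ * ((max 1 s) ^ 2)⁻¹ * Real.exp (-(δ * s / n)) * (n : ℝ) ^ (3 + 1)
        = C * ((n : ℝ) ^ 2 * ((max 1 s) ^ 2)⁻¹) * Real.exp (-(δ * s / n)) := by
      field_simp
    rw [e1]
    exact mul_le_mul (mul_le_mul_of_nonneg_right hCge₀ (by positivity)) (hexpmono hδle₀) (Real.exp_pos _).le (by positivity)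
  · have hb := h₁ k hk a' 0 hw.1 hw.2 le_rfl le_rfl μ x y
    rw [hLr, ← hnr, hsB, hfac] at hb
    have eμ : x + Pi.single μ 1 = x + e μ := rfl
    rw [eμ, ← hG, ← hG] at hb
    -- hb : n^4 * (n * |Δ|) ≤ C₁ * (n^3 * (max 1 s)^3⁻¹) * exp(−δ₁ (s/n))
    have hn5 : (0 : ℝ) < (n : ℝ) ^ (3 + 1) * (n : ℝ) := by positivity
    have key : |Ggh n a (x + e μ) y u v - Ggh n a x y u v|
        ≤ C₁ * ((n : ℝ) ^ 3 * ((max 1 s) ^ 3)⁻¹) * Real.exp (-(δ₁ * (s / (n : ℝ)))) / ((n : ℝ) ^ (3 + 1) * (n : ℝ)) := by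
      rw [le_div_iff₀ hn5]
      calc |Ggh n a (x + e μ) y u v - Ggh n a x y u v| * ((n : ℝ) ^ (3 + 1) * (n : ℝ))
          = (n : ℝ) ^ (3 + 1) * ((n : ℝ) * |Ggh n a (x + e μ) y u v - Ggh n a x y u v|) := by ring
        _ ≤ _ := hb
    refine key.trans ?_
    rw [div_le_iff₀ hn5]
    have e1 : C * ((n : ℝ) ^ 2)⁻¹ * ((max 1 s) ^ 3)⁻¹ * Real.exp (-(δ * s / n)) * ((n : ℝ) ^ (3 + 1) * (n : ℝ))
        = C * ((n : ℝ) ^ 3 * ((max 1 s) ^ 3)⁻¹) * Real.exp (-(δ * s / n)) := by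
      field_simp
    rw [e1]
    exact mul_le_mul (mul_le_mul_of_nonneg_right hCge₁ (by positivity)) (hexpmono hδle₁) (Real.exp_pos _).le (by positivity)
  · have hb := h₂ k hk a' 0 hw.1 hw.2 le_rfl le_rfl μ x y
    rw [hLr, ← hnr, hsB, hfac] at hb
    have eμ : y + Pi.single μ 1 = y + e μ := rfl
    rw [eμ, ← hG, ← hG] at hb
    have hn5 : (0 : ℝ) < (n : ℝ) ^ (3 + 1) * (n : ℝ) := by positivity
    have key : |Ggh n a x (y + e μ) u v - Ggh n a x y u v|
        ≤ C₂ * ((n : ℝ) ^ 3 * ((max 1 s) ^ 3)⁻¹) * Real.exp (-(δ₂ * (s / (n : ℝ)))) / ((n : ℝ) ^ (3 + 1) * (n : ℝ)) := by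
      rw [le_div_iff₀ hn5]
      calc |Ggh n a x (y + e μ) u v - Ggh n a x y u v| * ((n : ℝ) ^ (3 + 1) * (n : ℝ))
          = (n : ℝ) ^ (3 + 1) * ((n : ℝ) * |Ggh n a x (y + e μ) u v - Ggh n a x y u v|) := by ring
        _ ≤ _ := hb
    refine key.trans ?_
    rw [div_le_iff₀ hn5]
    have e1 : C * ((n : ℝ) ^ 2)⁻¹ * ((max 1 s) ^ 3)⁻¹ * Real.exp (-(δ * s / n)) * ((n : ℝ) ^ (3 + 1) * (n : ℝ))
        = C * ((n : ℝ) ^ 3 * ((max 1 s) ^ 3)⁻¹) * Real.exp (-(δ * s / n)) := by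
      field_simp
    rw [e1]
    exact mul_le_mul (mul_le_mul_of_nonneg_right hCge₂ (by positivity)) (hexpmono hδle₂) (Real.exp_pos _).le (by positivity)

end Profile

/-! ## §3 The n-FREE (θ-weighted) ℓ¹ row∕column masses of `Ggh (L^k) a` and of its lattice gradients -/

section Masses

variable {L : ℕ} (hL : 2 ≤ L) {a : ℝ} (ha : 0 < a)
include hL ha

omit hL ha in
/-- [folklore] **FROM A PROFILE TO A θ-WEIGHTED ℓ¹ MASS** (model-free): if `|K x y| ≤ C·(n²)⁻¹·(max 1 |x−y|_∞)^{−p}·e^{−δ|x−y|_∞∕n}` (`p ∈ {2,3}`,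
`n ≥ 1`) then for `θ ≤ δ∕(8n)` every θ-weighted row∕column sum `Σ'|K x y|·e^{θ|x−y|₁}` is summable and
`≤ C·(n²)⁻¹·(1 + 2560∕(δ∕(2n))^{4−p})`. -/
theorem tsum_weighted_le_of_profile {K : Site 4 → Site 4 → ℝ} {C δ : ℝ} (hC : 0 ≤ C) (hδ : 0 < δ) {n : ℕ} (hn : 1 ≤ n)
    {p : ℕ} (hp2 : 2 ≤ p) (hp3 : p ≤ 3)
    (hK : ∀ x y, |K x y| ≤ C * ((n : ℝ) ^ 2)⁻¹ * ((max 1 ((supNorm (x - y) : ℕ) : ℝ)) ^ p)⁻¹ *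
      Real.exp (-(δ * ((supNorm (x - y) : ℕ) : ℝ) / n)))
    {θ : ℝ} (hθ : θ ≤ δ / (8 * n)) (x : Site 4) :
    (Summable fun y : Site 4 => |K x y| * Real.exp (θ * l1 (x - y))) ∧
      ∑' y : Site 4, |K x y| * Real.exp (θ * l1 (x - y)) ≤ C * ((n : ℝ) ^ 2)⁻¹ * (1 + 2560 / (δ / (2 * n)) ^ (4 - p)) ∧
    (Summable fun y : Site 4 => |K y x| * Real.exp (θ * l1 (y - x))) ∧
      ∑' y : Site 4, |K y x| * Real.exp (θ * l1 (y - x)) ≤ C * ((n : ℝ) ^ 2)⁻¹ * (1 + 2560 / (δ / (2 * n)) ^ (4 - p)) := by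
  have hn0 : (0 : ℝ) < n := by exact_mod_cast hn
  have hc : 0 < δ / (2 * n) := by positivity
  -- the majorant profile `F u = C n⁻² (max 1 |u|)^{−p} e^{−(δ∕2n)|u|_∞}`
  set F : Site 4 → ℝ := fun u => C * ((n : ℝ) ^ 2)⁻¹ * (((max 1 ((supNorm u : ℕ) : ℝ)) ^ p)⁻¹ *
    Real.exp (-(δ / (2 * n) * ((supNorm u : ℕ) : ℝ)))) with hF
  have hF0 : ∀ u, 0 ≤ F u := fun u => by positivity
  have hmaj : ∀ x y, |K x y| * Real.exp (θ * l1 (x - y)) ≤ F (x - y) := by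
    intro x y
    have h1 := hK x y
    have hsl := (supNorm_le_l1_le (x - y)).2
    have hθl : θ * l1 (x - y) ≤ δ / (2 * n) * ((supNorm (x - y) : ℕ) : ℝ) := by
      calc θ * l1 (x - y) ≤ δ / (8 * n) * (4 * ((supNorm (x - y) : ℕ) : ℝ)) :=
            mul_le_mul hθ hsl (l1_nonneg _) (by positivity)
        _ = δ / (2 * n) * ((supNorm (x - y) : ℕ) : ℝ) := by field_simp; ring
    have hexp : Real.exp (-(δ * ((supNorm (x - y) : ℕ) : ℝ) / n)) * Real.exp (θ * l1 (x - y))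
        ≤ Real.exp (-(δ / (2 * n) * ((supNorm (x - y) : ℕ) : ℝ))) := by
      rw [← Real.exp_add, Real.exp_le_exp]
      have : δ * ((supNorm (x - y) : ℕ) : ℝ) / n = 2 * (δ / (2 * n) * ((supNorm (x - y) : ℕ) : ℝ)) := by field_simp
      rw [this]; linarith
    calc |K x y| * Real.exp (θ * l1 (x - y))
        ≤ (C * ((n : ℝ) ^ 2)⁻¹ * ((max 1 ((supNorm (x - y) : ℕ) : ℝ)) ^ p)⁻¹ * Real.exp (-(δ * ((supNorm (x - y) : ℕ) : ℝ) / n)))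
            * Real.exp (θ * l1 (x - y)) := mul_le_mul_of_nonneg_right h1 (Real.exp_pos _).le
      _ = C * ((n : ℝ) ^ 2)⁻¹ * (((max 1 ((supNorm (x - y) : ℕ) : ℝ)) ^ p)⁻¹ *
            (Real.exp (-(δ * ((supNorm (x - y) : ℕ) : ℝ) / n)) * Real.exp (θ * l1 (x - y)))) := by ring
      _ ≤ F (x - y) := by
          rw [hF]
          exact mul_le_mul_of_nonneg_left (mul_le_mul_of_nonneg_left hexp (by positivity)) (by positivity)
  -- finite sums of the majorant over ANY finite set are bounded
  have hfin : ∀ S : Finset (Site 4), ∑ u ∈ S, F u ≤ C * ((n : ℝ) ^ 2)⁻¹ * (1 + 2560 / (δ / (2 * n)) ^ (4 - p)) := by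
    intro S
    rw [hF, ← Finset.mul_sum]
    exact mul_le_mul_of_nonneg_left (sum_profile4_le hc hp2 hp3 S) (by positivity)
  have hrow : ∀ S : Finset (Site 4), ∑ y ∈ S, |K x y| * Real.exp (θ * l1 (x - y)) ≤
      C * ((n : ℝ) ^ 2)⁻¹ * (1 + 2560 / (δ / (2 * n)) ^ (4 - p)) := by
    intro S
    calc ∑ y ∈ S, |K x y| * Real.exp (θ * l1 (x - y)) ≤ ∑ y ∈ S, F (x - y) := Finset.sum_le_sum fun y _ => hmaj x y
      _ = ∑ y ∈ S, F ((Equiv.subLeft x) y) := rfl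
      _ = ∑ u ∈ S.map (Equiv.subLeft x).toEmbedding, F u := (Finset.sum_map S (Equiv.subLeft x).toEmbedding F).symm
      _ ≤ _ := hfin _
  have hcol : ∀ S : Finset (Site 4), ∑ y ∈ S, |K y x| * Real.exp (θ * l1 (y - x)) ≤
      C * ((n : ℝ) ^ 2)⁻¹ * (1 + 2560 / (δ / (2 * n)) ^ (4 - p)) := by
    intro S
    calc ∑ y ∈ S, |K y x| * Real.exp (θ * l1 (y - x)) ≤ ∑ y ∈ S, F (y - x) := Finset.sum_le_sum fun y _ => hmaj y x
      _ = ∑ y ∈ S, F ((Equiv.subRight x) y) := rfl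
      _ = ∑ u ∈ S.map (Equiv.subRight x).toEmbedding, F u := (Finset.sum_map S (Equiv.subRight x).toEmbedding F).symm
      _ ≤ _ := hfin _
  have hnn1 : ∀ y, 0 ≤ |K x y| * Real.exp (θ * l1 (x - y)) := fun y => by positivity
  have hnn2 : ∀ y, 0 ≤ |K y x| * Real.exp (θ * l1 (y - x)) := fun y => by positivity
  exact ⟨summable_of_sum_le hnn1 hrow, Real.tsum_le_of_sum_le hnn1 hrow, summable_of_sum_le hnn2 hcol, Real.tsum_le_of_sum_le hnn2 hcol⟩

/-- [folklore] **«GGH-MASS» — THE n-FREE (θ-WEIGHTED) ℓ¹ ROW∕COLUMN MASSES OF THE SCALAR GHOST LEG AND OF ITS LATTICE GRADIENTS ON THE SCALES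
`n = L^k`** (the analytic letter `g₀` of the (C1)(C2) count, W-1 l.43312 (F2)(F3), and its gradient companion `g₁∕n` for (C1)): there are `δ > 0`
and `g₀, g₁ ≥ 0` (depending on `L ≥ 2`, `a > 0` only) such that for every `k ≥ 1`, `n = L^k`, every `θ ≤ δ∕(8n)`, all `x`, `u v`, `μ`:
`Σ'_y |Ggh n a x y|·e^{θ|x−y|₁} ≤ g₀` (rows; columns by `Ggh_symm`), `Σ'_y |Ggh n a (x+e_μ) y − Ggh n a x y|·e^{θ|x−y|₁} ≤ g₁∕n`,
`Σ'_y |Ggh n a (y+e_μ) x − Ggh n a y x|·e^{θ|y−x|₁} ≤ g₁∕n` and `Σ'_y |Ggh n a x (y+e_μ) − Ggh n a x y|·e^{θ|x−y|₁} ≤ g₁∕n` (all summable) —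
the TRUE powers (`n⁰`, `n⁻¹`) where the road's sup letters give `n⁴`, `n⁴`. -/
theorem exists_Ggh_masses : ∃ δ g₀ g₁ : ℝ, 0 < δ ∧ 0 ≤ g₀ ∧ 0 ≤ g₁ ∧ ∀ (k : ℕ), 1 ≤ k → ∀ (n : ℕ) [NeZero n], n = L ^ k →
    ∀ θ : ℝ, θ ≤ δ / (8 * n) → ∀ (x : Site 4) (u v : Unit),
      ((Summable fun y : Site 4 => |Ggh n a x y u v| * Real.exp (θ * l1 (x - y))) ∧
        ∑' y : Site 4, |Ggh n a x y u v| * Real.exp (θ * l1 (x - y)) ≤ g₀) ∧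
      (∀ μ : Fin 4,
        (Summable fun y : Site 4 => |Ggh n a (x + e μ) y u v - Ggh n a x y u v| * Real.exp (θ * l1 (x - y))) ∧
          ∑' y : Site 4, |Ggh n a (x + e μ) y u v - Ggh n a x y u v| * Real.exp (θ * l1 (x - y)) ≤ g₁ / n ∧
        (Summable fun y : Site 4 => |Ggh n a (y + e μ) x u v - Ggh n a y x u v| * Real.exp (θ * l1 (y - x))) ∧
          ∑' y : Site 4, |Ggh n a (y + e μ) x u v - Ggh n a y x u v| * Real.exp (θ * l1 (y - x)) ≤ g₁ / n ∧
        (Summable fun y : Site 4 => |Ggh n a x (y + e μ) u v - Ggh n a x y u v| * Real.exp (θ * l1 (x - y))) ∧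
          ∑' y : Site 4, |Ggh n a x (y + e μ) u v - Ggh n a x y u v| * Real.exp (θ * l1 (x - y)) ≤ g₁ / n) := by
  obtain ⟨δ, C, hδ, hC, h⟩ := exists_Ggh_profile hL ha
  refine ⟨δ, C * (1 + 2560 * (2 / δ) ^ 2), C * (1 + 2560 * (2 / δ)), hδ, by positivity, by positivity,
    fun k hk n _ hn θ hθ x u v => ?_⟩
  have hn1 : 1 ≤ n := NeZero.one_le
  have hn1r : (1 : ℝ) ≤ n := by exact_mod_cast hn1
  have hn0 : (0 : ℝ) < n := by positivity
  obtain hP := h k hk n hn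
  -- the arithmetic of the two bounds
  have e2 : C * ((n : ℝ) ^ 2)⁻¹ * (1 + 2560 / (δ / (2 * n)) ^ (4 - 2)) ≤ C * (1 + 2560 * (2 / δ) ^ 2) := by
    rw [show (4 - 2 : ℕ) = 2 from rfl]
    have e : C * ((n : ℝ) ^ 2)⁻¹ * (1 + 2560 / (δ / (2 * n)) ^ 2) = C * (((n : ℝ) ^ 2)⁻¹ + 2560 * (2 / δ) ^ 2) := by
      field_simp
    rw [e]
    refine mul_le_mul_of_nonneg_left (add_le_add ?_ le_rfl) hC.le
    calc ((n : ℝ) ^ 2)⁻¹ ≤ 1⁻¹ := by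
          exact inv_anti₀ one_pos (one_le_pow₀ hn1r)
      _ = 1 := inv_one
  have e3 : C * ((n : ℝ) ^ 2)⁻¹ * (1 + 2560 / (δ / (2 * n)) ^ (4 - 3)) ≤ C * (1 + 2560 * (2 / δ)) / n := by
    rw [show (4 - 3 : ℕ) = 1 from rfl, pow_one]
    have e : C * ((n : ℝ) ^ 2)⁻¹ * (1 + 2560 / (δ / (2 * n))) = (C * (((n : ℝ))⁻¹ + 2560 * (2 / δ))) / n := by
      field_simp
    rw [e]
    refine div_le_div_of_nonneg_right (mul_le_mul_of_nonneg_left (add_le_add ?_ le_rfl) hC.le) hn0.le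
    calc ((n : ℝ))⁻¹ ≤ 1⁻¹ := inv_anti₀ one_pos hn1r
      _ = 1 := inv_one
  have hv := tsum_weighted_le_of_profile (K := fun x y => Ggh n a x y u v) hC.le hδ hn1 (p := 2) le_rfl (by norm_num)
    (fun x y => (hP x y u v).1) hθ x
  have hdx : ∀ μ, _ := fun μ : Fin 4 => tsum_weighted_le_of_profile (K := fun x y => Ggh n a (x + e μ) y u v - Ggh n a x y u v)
    hC.le hδ hn1 (p := 3) (by norm_num) le_rfl (fun x y => (hP x y u v).2.1 μ) hθ x
  have hdy : ∀ μ, _ := fun μ : Fin 4 => tsum_weighted_le_of_profile (K := fun x y => Ggh n a x (y + e μ) u v - Ggh n a x y u v)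
    hC.le hδ hn1 (p := 3) (by norm_num) le_rfl (fun x y => (hP x y u v).2.2 μ) hθ x
  exact ⟨⟨hv.1, hv.2.1.trans e2⟩, fun μ => ⟨(hdx μ).1, (hdx μ).2.1.trans e3, (hdx μ).2.2.1, (hdx μ).2.2.2.trans e3,
    (hdy μ).1, (hdy μ).2.1.trans e3⟩⟩

end Masses

end Summit.QuantumFields.BalabanUV.Beta.D1BFx.GhostLegProfile

end
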